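import Summits.CriticalPhenomena.Ising3D.Control2DMidCheck
import Summits.CriticalPhenomena.Ising3D.Control2DCellScheme
import Mathlib.Tactic.NormNum
import HarnessLib

/-!
# The 2D control: the kernel checker for obligation (C)
(cell `pub-ising3x`, seat controls-1; evaluates `Control2DCellScheme.lean` in the arithmetic of
`Control2DArith.lean`; soundness in `Control2DCellSound.lean`)

HONEST FRAMING: lottery ticket; floor = tightest certified 3D Ising CFT bounds; no exact-solution
claim without a proof.

For one even spin `ℓ` and a CUT LIST `T₀ < T₁ < … < T_K` of dyadic rationals (plus one extra stencil
point beyond `T_K`), the checker decides, cell by cell, the two value inequalities of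
`Control2DCellScheme.PsiC_nonneg_on_cell` for the point functional of a certificate at `Δ_σ = 1/8`:
at every cut point `t` it encloses, per evaluation datum `d`, `f_d(t) = (x_d y_d)^{t/2}` (integer part
of the exponent by `Nat.pow` and one rounding, dyadic part by the checked square-root chain — `dyPow`)
and `b_d(t) = brR N ℓ t x_d y_d` (the chiral coefficients `a_m(η)` by their rational recursion
`a_{m+1} = a_m (η+m)²/((m+1)(2η+m))`, `a_1 = η/2`, in interval arithmetic — `coefs`; the truncated
series by Horner at each of the finitely many DISTINCT coordinate values — `Atab`; then
`b_d = r₁ A(h;x) A(h̄;y) + r₂ A(h̄;x) A(h;y)` — `brOf`), and per cell the four outward-rounded sums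
`F1lo, F2hi, G0hi, G1hi` (`sums4`) and the test `cellOKC`. `checkSpin` runs a whole cut list.
All arithmetic is on `ℕ` (`NI`); the data `CDat` are built once per run by `mkCData`.

Mirror / second implementation: `HOME/code/controls/c2dkernel/c2d_cells.py` (exact integers, same
rounding; it generated the cut lists by adaptive bisection and predicts every kernel verdict).
-/

namespace Summit.CriticalPhenomena.Ising3D.Control2D

open Set Finset
open Literature.MathematicalPhysics.QuantumFieldTheory.ConformalBootstrap3D

/-! ### Kernel data for (C) -/

/-- The kernel datum of one evaluation point for spin `ℓ`: sign, `|c_d|` enclosed, the indices of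
`x, y` in the list of distinct coordinate values, `xy` as a fraction of naturals, enclosures of
`(x/y)^{ℓ/2}` and `(y/x)^{ℓ/2}`, and the square-root chain of `xy`. [folklore] -/
structure CDat where
  /-- sign `σ_d` (`true` = `+`) -/
  pos : Bool
  /-- encloses `|c_d|` -/
  cabs : NI
  /-- index of `x` in the value list -/
  ix : ℕ
  /-- index of `y` in the value list -/
  iy : ℕ
  /-- numerator of `xy` -/
  xyn : ℕ
  /-- denominator of `xy` -/
  xyd : ℕ
  /-- encloses `(x/y)^{ℓ/2}` -/
  r1 : NI
  /-- encloses `(y/x)^{ℓ/2}` -/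
  r2 : NI
  /-- `ch[k]` encloses `(xy)^{1/2^{k+1}}` -/
  ch : List NI

/-- The kernel datum of a point with sign `pos`, coefficient `|w| · base^{1/8}`, rational coordinates
`x, y` (looked up in `vals`), at spin `ℓ`. [folklore] -/
def mkCDat (P depth ℓ : ℕ) (vals : List ℚ) (pos : Bool) (wabs base x y : ℚ) : CDat :=
  ⟨pos, (NI.ofRat P wabs).mul P (NI.sqrtIter P 3 (NI.ofRat P base)), vals.idxOf x, vals.idxOf y,
    (x * y).num.toNat, (x * y).den, NI.ofRat P ((x / y) ^ (ℓ / 2)), NI.ofRat P ((y / x) ^ (ℓ / 2)),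
    sqrtChain P depth (NI.ofRat P (x * y))⟩

/-- The kernel data of a certificate at spin `ℓ` (direct data, then reflected data — the order of
`Control2DMidScheme.realData`). [folklore] -/
def mkCData {n : ℕ} (P depth ℓ : ℕ) (vals : List ℚ) (w z zb : Fin n → ℚ) : List CDat :=
  (List.ofFn fun k => mkCDat P depth ℓ vals (decide (0 ≤ w k)) |w k| ((1 - z k) * (1 - zb k)) (z k) (zb k)) ++
  (List.ofFn fun k => mkCDat P depth ℓ vals (decide (w k ≤ 0)) |w k| (z k * zb k) (1 - z k) (1 - zb k))

/-! ### The chiral series in interval arithmetic -/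

/-- The factor `φ_m(η)` of the coefficient recursion, over `ℚ`. [folklore] -/
def facQ (η : ℚ) (m : ℕ) : ℚ :=
  if m = 0 then η / 2 else (η + m) * (η + m) / (((m : ℚ) + 1) * (2 * η + m))

/-- `[a_m, a_{m+1}, …]` (`k` entries) from `a_m = a`. [folklore] -/
def coefsAux (P : ℕ) (η : ℚ) : ℕ → ℕ → NI → List NI
  | 0, _, _ => []
  | k + 1, m, a => a :: coefsAux P η k (m + 1) (a.mul P (NI.ofRat P (facQ η m)))

/-- The coefficient enclosures `[a_0(η), …, a_{N-1}(η)]`. [folklore] -/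
def coefs (P N : ℕ) (η : ℚ) : List NI := coefsAux P η N 0 (NI.one P)

/-- Horner evaluation of `Σ_m a_m v^m` from a coefficient list `[a_0, a_1, …]`. [folklore] -/
def hornerL (P : ℕ) (v : NI) : List NI → NI
  | [] => NI.zero
  | a :: rest => a.add ((hornerL P v rest).mul P v)

/-- The truncated series `A_N(η; v)` at every value of the list. [folklore] -/
def Atab (P N : ℕ) (η : ℚ) (vni : List NI) : List NI :=
  let cs := coefs P N η
  vni.map fun v => hornerL P v cs

/-! ### Powers of `xy` with dyadic exponents -/

/-- `(xy)^q`, exactly then rounded once. [folklore] -/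
def xyPowC (P : ℕ) (d : CDat) (q : ℕ) : NI := NI.ofNatFrac P (d.xyn ^ q) (d.xyd ^ q)

/-- Chain element `k` (`∋ (xy)^{1/2^{k+1}}`), `[0, 1]` beyond the chain. [folklore] -/
def chAtC (P : ℕ) (d : CDat) (k : ℕ) : NI := d.ch.getD k ⟨0, 2 ^ P⟩

/-- `(xy)^{a / 2^r}` by binary descent on the exponent. [folklore] -/
def dyPow (P : ℕ) (d : CDat) (a : ℕ) : ℕ → NI
  | 0 => xyPowC P d a
  | r + 1 =>
    let rest := dyPow P d (a / 2) r
    if a % 2 = 0 then rest else rest.mul P (chAtC P d r)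

/-- A non-negative dyadic rational (denominator a power of two). [folklore] -/
def dyOK (t : ℚ) : Bool := decide (0 ≤ t) && decide (t.den = 2 ^ Nat.log2 t.den)

/-! ### One point, one cell, one spin -/

/-- `b_d = r₁ A(h;x) A(h̄;y) + r₂ A(h̄;x) A(h;y)` from the two series tables. [folklore] -/
def brOf (P : ℕ) (d : CDat) (Ah Ab : List NI) : NI :=
  ((d.r1.mul P (Ah.getD d.ix NI.zero)).mul P (Ab.getD d.iy NI.zero)).add
    ((d.r2.mul P (Ab.getD d.ix NI.zero)).mul P (Ah.getD d.iy NI.zero))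

/-- The enclosures `(f_d(t), b_d(t))` of all data at the dyadic point `t`. [folklore] -/
def pointC (P N ℓ : ℕ) (vni : List NI) (cds : List CDat) (t : ℚ) : List (NI × NI) :=
  let a := t.num.toNat
  let r := Nat.log2 t.den
  let Ah := Atab P N ((t + ℓ) / 2) vni
  let Ab := Atab P N ((t - ℓ) / 2) vni
  cds.map fun d => (dyPow P d a (r + 1), brOf P d Ah Ab)

/-- The four sums of a cell `[t₀, t₁]` with stencil `t₂`: `(F1lo, F2hi, G0hi, G1hi)` —
`F(·) = Σ_{σ=+} c b(t₀) f(·)` at `t₁` (lower) and `t₂` (upper), `G(·) = Σ_{σ=-} c b(t₁) f(·)` at `t₀`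
and `t₁` (upper). [folklore] -/
def sums4 (P : ℕ) : List CDat → List (NI × NI) → List (NI × NI) → List (NI × NI) → ℕ × ℕ × ℕ × ℕ
  | d :: ds, p0 :: q0, p1 :: q1, p2 :: q2 =>
    let acc := sums4 P ds q0 q1 q2
    if d.pos then
      (acc.1 + ((d.cabs.mul P p1.1).mul P p0.2).lo, acc.2.1 + ((d.cabs.mul P p2.1).mul P p0.2).hi,
        acc.2.2.1, acc.2.2.2)
    else
      (acc.1, acc.2.1, acc.2.2.1 + ((d.cabs.mul P p0.1).mul P p1.2).hi,
        acc.2.2.2 + ((d.cabs.mul P p1.1).mul P p1.2).hi)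
  | _, _, _, _ => (0, 0, 0, 0)

/-- The two inequalities of a cell: `G1hi ≤ F1lo` and `G0hi ≤ F1lo + (H/H₃)(F1lo - F2hi)`.
[folklore] -/
def cellOKC (S : ℕ × ℕ × ℕ × ℕ) (H H3 : ℚ) : Bool :=
  decide (S.2.2.2 ≤ S.1) && decide ((S.2.2.1 : ℚ) ≤ S.1 + H / H3 * ((S.1 : ℚ) - S.2.1))

/-- **The spin checker**: cut list `T` (cells `[T_k, T_{k+1}]`) and an extra stencil point; all points
dyadic, `≥ ℓ`, strictly increasing; every cell passes `cellOKC`. [folklore] -/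
def checkSpin (P N ℓ : ℕ) (vni : List NI) (cds : List CDat) (T : List ℚ) (extra : ℚ) : Bool :=
  let Tx := T ++ [extra]
  let PT := Tx.map (pointC P N ℓ vni cds)
  (Tx.all fun t => dyOK t && decide ((ℓ : ℚ) ≤ t)) &&
  allBelow (fun k => decide (Tx.getD k 0 < Tx.getD (k + 1) 0)) T.length &&
  allBelow (fun k => cellOKC (sums4 P cds (PT.getD k []) (PT.getD (k + 1) []) (PT.getD (k + 2) []))
    (Tx.getD (k + 1) 0 - Tx.getD k 0) (Tx.getD (k + 2) 0 - Tx.getD (k + 1) 0)) (T.length - 1)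

end Summit.CriticalPhenomena.Ising3D.Control2D
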